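import Summits.ResolutionOfSingularities.ResolutionOfSingularities.Theses.MaxContactCut
import Summits.ResolutionOfSingularities.ResolutionOfSingularities.Theorems.MonomialTowerClasses
import Summits.ResolutionOfSingularities.ResolutionOfSingularities.Theorems.MaxContactCutForcedTowers
import Summits.ResolutionOfSingularities.ResolutionOfSingularities.Theorems.MaxContactCutDivergentTowers
import HarnessLib

/-!
# MaxContactCutMonomialTowers — kernels of the decomp-res node «MonomialTowers» (lens-4 g9) BY NAME

Source HOME/decomp-res-lens-4/g9/MonomialTowers.lean (sha256 8f38f901f7de0d3e; ForcedTowers rev 3; critic `lean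
check` rc 0, 0 sorry, `core_of_pieces` axioms standard), CRITIC-LEDGER row 58 (2026-08-30T08:32Z): CLEARED (MAP +1,
DECIDED +1, residual 0; (M1) paper proof re-walked SOUND; (M2) KNOWN; COLLAPSE: transversal ⟸ (M1⁺) alone).  The
node refines MaxContactCut's aside `NoForcedTowers` (30253) — and through the landed `MaxContactCutForcedTowers`
kernels the located dim-4 core in sequence form `RungOne` (29273), `StepDimFour` (28011), `StepPICoreDimFour`
(28544) — by the monomial corner normal form of `Theorems/MonomialTowerClasses`:

* `NoForcedTowers ⟺ NoTransversalTowers ∧ NoHuggingTowers`, `NoHuggingTowers ⟺ NoContactHuggingTowers ∧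
  NoWildHuggingTowers` — EXACT by excluded middle (`noForcedTowers_iff_transversal_hugging`,
  `noHuggingTowers_iff_contact_wild`);
* `NoTransversalTowers` is DECIDED for ALL ground fields modulo the port-with-proof `CornerNormalFormAll` ((M1⁺),
  an aside = prover target #18) by the PROVED exhaustive-slot kernel (`noTransversalTowers_of_cornerNormalForm`);
  hence `NoForcedTowers ⟺ NoHuggingTowers` modulo (M1⁺) (`noForcedTowers_iff_hugging`) — the hugging class is THE
  located residual of the tower side;
* up BY NAME: `rungOne_of_pieces` (29273), `core_of_pieces` / `core_of_leaves` (28544), `e_one_iff_hugging` (EXACT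
  modulo the row-47 ports); down: every g9 aside is implied by 30253 (`pieces_of_noForcedTowers`);
* links to generation 8 (`MaxContactCutDivergentTowers`): `NoTransversalTowers → NoCoreValuativeTowers` (31261; the
  critic's ERRATUM on row 52: the valuative residual is decided elementary), `NoHuggingTowers →
  NoCoreGermHuggingTowers` (31260), and g7's `NoGrowingTowers` (30257) lives inside the hugging class.

Pure logic over the class files; every proof is a few lines.
(Sources: BierstoneGrigorievMilmanWlodarczyk2011 §3, Lemma 3.2.2; Kollar2007 3.35–3.37, 3.75; Shannon1973;
HeinzerOlberdingToeniskoetter2017; CossartJannsenSaito2020; Cutkosky2009.)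
-/

namespace Summit.ResolutionOfSingularities.ResolutionOfSingularities.Theorems.MaxContactCutMonomialTowers

open Summit.ResolutionOfSingularities.ResolutionOfSingularities.Theses
open Summit.ResolutionOfSingularities.ResolutionOfSingularities.Theorems
open WeakOrderReduction ForcedTowerClasses DivergentTowerClasses MonomialTowerClasses

/-! ## EXACT leaf calculus of the g9 refinement -/

/-- **EXACT**: `NoForcedTowers (30253) ⟺ NoTransversalTowers ∧ NoHuggingTowers` (excluded middle on «hugs some
germ»). [folklore] -/
theorem noForcedTowers_iff_transversal_hugging :
    MaxContactCut.NoForcedTowers ↔ MaxContactCut.NoTransversalTowers ∧ MaxContactCut.NoHuggingTowers :=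
  ⟨fun h => ⟨fun n hn => (forcedTowersTerminate_iff_transversal_hugging.mp (h n hn)).1,
      fun n hn => (forcedTowersTerminate_iff_transversal_hugging.mp (h n hn)).2⟩,
    fun h n hn => forcedTowersTerminate_iff_transversal_hugging.mpr ⟨h.1 n hn, h.2 n hn⟩⟩

/-- **EXACT**: `NoHuggingTowers ⟺ NoContactHuggingTowers ∧ NoWildHuggingTowers`. [folklore] -/
theorem noHuggingTowers_iff_contact_wild :
    MaxContactCut.NoHuggingTowers ↔ MaxContactCut.NoContactHuggingTowers ∧ MaxContactCut.NoWildHuggingTowers :=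
  ⟨fun h => ⟨fun n hn => (huggingTowersTerminate_iff_contact_wild.mp (h n hn)).1,
      fun n hn => (huggingTowersTerminate_iff_contact_wild.mp (h n hn)).2⟩,
    fun h n hn => huggingTowersTerminate_iff_contact_wild.mpr ⟨h.1 n hn, h.2 n hn⟩⟩

/-- Every g9 aside is implied by 30253 (WEAKER-or-equal by construction). [folklore] -/
theorem pieces_of_noForcedTowers (h : MaxContactCut.NoForcedTowers) :
    MaxContactCut.NoTransversalTowers ∧ MaxContactCut.NoHuggingTowers ∧ MaxContactCut.NoContactHuggingTowers ∧
      MaxContactCut.NoWildHuggingTowers :=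
  ⟨fun n hn => (pieces_of_ftt (h n hn)).1, fun n hn => (pieces_of_ftt (h n hn)).2.1,
    fun n hn => (pieces_of_ftt (h n hn)).2.2.1, fun n hn => (pieces_of_ftt (h n hn)).2.2.2⟩

/-! ## The decided piece: transversal towers modulo (M1⁺) alone -/

/-- **`CornerNormalFormAll → NoTransversalTowers`** (the PROVED exhaustive-slot kernel of
`MonomialTowerClasses`; all ground fields). [folklore] -/
theorem noTransversalTowers_of_cornerNormalForm (hN : MaxContactCut.CornerNormalFormAll) :
    MaxContactCut.NoTransversalTowers :=
  fun n hn => transversalTowersTerminate_of_cornerNormalFormPlus hn (hN n hn)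

/-- Variant modulo the weaker (M1) and the plain combinatorial leaf `NoCornerTower d n`, `d ≤ 4` (KNOWN modulo
`CornerModel` + `TowerObstructs`, ATTACKABLE directly — cheap theorem #17′). [folklore] -/
theorem noTransversalTowers_of_ports (hN : ∀ n : ℕ, 1 ≤ n → CornerNormalForm n)
    (hC : ∀ n : ℕ, 1 ≤ n → ∀ d : ℕ, d ≤ 4 → NoCornerTower d n) : MaxContactCut.NoTransversalTowers :=
  fun n hn => transversalTowersTerminate_of_ports (hN n hn) (hC n hn)

/-- The combinatorial leaf from the bookkeeping ports. [folklore] -/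
theorem noCornerTowers_of_model (hM : ∀ n : ℕ, 1 ≤ n → CornerModel n) (hT : ∀ n : ℕ, 1 ≤ n → TowerObstructs n) :
    ∀ n : ℕ, 1 ≤ n → ∀ d : ℕ, d ≤ 4 → NoCornerTower d n :=
  fun n hn => noCornerTower_of_model (hM n hn) (hT n hn)

/-! ## Up: the asides settle 30253, RungOne (29273) and the core 28544 BY NAME -/

/-- **30253 from the pieces**: (M1⁺) + the hugging residual. [folklore] -/
theorem noForcedTowers_of_pieces (hN : MaxContactCut.CornerNormalFormAll) (hH : MaxContactCut.NoHuggingTowers) :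
    MaxContactCut.NoForcedTowers :=
  fun n hn => forcedTowersTerminate_of_hugging' hn (hN n hn) (hH n hn)

/-- **EXACT modulo the decided piece: `NoForcedTowers ⟺ NoHuggingTowers`.** [folklore] -/
theorem noForcedTowers_iff_hugging (hN : MaxContactCut.CornerNormalFormAll) :
    MaxContactCut.NoForcedTowers ↔ MaxContactCut.NoHuggingTowers :=
  ⟨fun h => (pieces_of_noForcedTowers h).2.1, noForcedTowers_of_pieces hN⟩

/-- 30253 from (M1⁺) and the two hugging LEAVES. [folklore] -/
theorem noForcedTowers_of_leaves (hN : MaxContactCut.CornerNormalFormAll)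
    (h₁ : MaxContactCut.NoContactHuggingTowers) (h₂ : MaxContactCut.NoWildHuggingTowers) :
    MaxContactCut.NoForcedTowers :=
  noForcedTowers_of_pieces hN (noHuggingTowers_iff_contact_wild.mpr ⟨h₁, h₂⟩)

/-- **`E 1` from the node**: row-47 ports + (M1⁺) + hugging residual + the nowhere-isolated aside (30254).
[folklore] -/
theorem e_one_of_pieces (hS : ∀ n : ℕ, 1 ≤ n → ForcedSeed n) (hD : ∀ n : ℕ, 1 ≤ n → ForcedDescent n)
    (hN : MaxContactCut.CornerNormalFormAll) (hH : MaxContactCut.NoHuggingTowers)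
    (hNI : MaxContactCut.NowhereIsolatedReduction) : E 1 :=
  MaxContactCutForcedTowers.e_one_of_forced hS hD (noForcedTowers_of_pieces hN hH) hNI

/-- **RungOne (29273) BY NAME.** [folklore] -/
theorem rungOne_of_pieces (hS : ∀ n : ℕ, 1 ≤ n → ForcedSeed n) (hD : ∀ n : ℕ, 1 ≤ n → ForcedDescent n)
    (hN : MaxContactCut.CornerNormalFormAll) (hH : MaxContactCut.NoHuggingTowers)
    (hNI : MaxContactCut.NowhereIsolatedReduction) : MaxContactCut.RungOne :=
  MaxContactCutForcedTowers.rungOne_of_e_one (e_one_of_pieces hS hD hN hH hNI)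

/-- **The located dim-4 core 28544 BY NAME** (landed `core_of_forced`). [folklore] -/
theorem core_of_pieces (hS : ∀ n : ℕ, 1 ≤ n → ForcedSeed n) (hD : ∀ n : ℕ, 1 ≤ n → ForcedDescent n)
    (hN : MaxContactCut.CornerNormalFormAll) (hH : MaxContactCut.NoHuggingTowers)
    (hNI : MaxContactCut.NowhereIsolatedReduction) (hStep : MaxContactCut.SequenceToStepAll) :
    MaxContactCut.StepPICoreDimFour :=
  MaxContactCutForcedTowers.core_of_forced hS hD (noForcedTowers_of_pieces hN hH) hNI hStep

/-- The core from the ports and the two UNDECIDED hugging leaves. [folklore] -/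
theorem core_of_leaves (hS : ∀ n : ℕ, 1 ≤ n → ForcedSeed n) (hD : ∀ n : ℕ, 1 ≤ n → ForcedDescent n)
    (hN : MaxContactCut.CornerNormalFormAll) (h₁ : MaxContactCut.NoContactHuggingTowers)
    (h₂ : MaxContactCut.NoWildHuggingTowers) (hNI : MaxContactCut.NowhereIsolatedReduction)
    (hStep : MaxContactCut.SequenceToStepAll) : MaxContactCut.StepPICoreDimFour :=
  core_of_pieces hS hD hN (noHuggingTowers_iff_contact_wild.mpr ⟨h₁, h₂⟩) hNI hStep

/-- EXACT modulo all ports: `E 1 ⟺ NoHuggingTowers ∧ NowhereIsolatedReduction`. [folklore] -/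
theorem e_one_iff_hugging (hS : ∀ n : ℕ, 1 ≤ n → ForcedSeed n) (hD : ∀ n : ℕ, 1 ≤ n → ForcedDescent n)
    (hT : ∀ n : ℕ, 1 ≤ n → TowerObstructs n) (hN : MaxContactCut.CornerNormalFormAll) :
    E 1 ↔ MaxContactCut.NoHuggingTowers ∧ MaxContactCut.NowhereIsolatedReduction := by
  rw [MaxContactCutForcedTowers.e_one_iff_forced hS hD hT, noForcedTowers_iff_hugging hN]

/-- … and at the blocker: under `E 2`, `RungOne ⟺ NoHuggingTowers ∧ NowhereIsolatedReduction` modulo the ports.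
[folklore] -/
theorem rungOne_iff_hugging (hS : ∀ n : ℕ, 1 ≤ n → ForcedSeed n) (hD : ∀ n : ℕ, 1 ≤ n → ForcedDescent n)
    (hT : ∀ n : ℕ, 1 ≤ n → TowerObstructs n) (hN : MaxContactCut.CornerNormalFormAll) (hE2 : E 2) :
    MaxContactCut.RungOne ↔ MaxContactCut.NoHuggingTowers ∧ MaxContactCut.NowhereIsolatedReduction :=
  (MaxContactCutForcedTowers.rungOne_iff_of_e_two hE2).trans (e_one_iff_hugging hS hD hT hN)

/-! ## Links to the generation-7/8 asides -/

/-- g8's located residual `NoCoreValuativeTowers` (31261) is INSIDE the decided transversal piece (the critic's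
ERRATUM on row 52). [folklore] -/
theorem noCoreValuativeTowers_of_transversal (h : MaxContactCut.NoTransversalTowers) :
    MaxContactCut.NoCoreValuativeTowers :=
  fun n hn p hp k _ _ T g hB hD hE _ _ hNG => h n hn p hp k T g hB hD hE hNG

/-- … so modulo (M1⁺) it is decided outright. [folklore] -/
theorem noCoreValuativeTowers_of_cornerNormalForm (hN : MaxContactCut.CornerNormalFormAll) :
    MaxContactCut.NoCoreValuativeTowers :=
  noCoreValuativeTowers_of_transversal (noTransversalTowers_of_cornerNormalForm hN)

/-- g8's `NoCoreGermHuggingTowers` (31260) is inside the hugging residual. [folklore] -/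
theorem noCoreGermHuggingTowers_of_hugging (h : MaxContactCut.NoHuggingTowers) :
    MaxContactCut.NoCoreGermHuggingTowers :=
  fun n hn p hp k _ _ T g hB hD hE _ _ hG => h n hn p hp k T g hB hD hE hG

/-- Conversely the hugging residual follows from g8's asides `NoEventuallyFreeTowers` (31258), `NoTauTwoHuggingTowers`
(31259) — both DECIDED-MOD-PORT over perfect fields — and the all-classes germ-hugging leaf. [folklore] -/
theorem noHuggingTowers_of_ttLeaves (hF : MaxContactCut.NoEventuallyFreeTowers)
    (h2 : MaxContactCut.NoTauTwoHuggingTowers) (hG : ∀ n : ℕ, 1 ≤ n → GermHuggingTowersTerminate n) :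
    MaxContactCut.NoHuggingTowers :=
  fun n hn => huggingTowersTerminate_of_ttLeaves (hF n hn) (h2 n hn) (hG n hn)

/-- g7's p-core leaf `NoGrowingTowers` (30257) is located INSIDE the hugging class (mod (M1)). [folklore] -/
theorem noGrowingTowers_of_hugging (hN : MaxContactCut.CornerNormalFormAll)
    (h : ∀ n : ℕ, 1 ≤ n → NoTower n fun T => GermHugging T ∧ ¬ T.EventuallyStationary) :
    MaxContactCut.NoGrowingTowers :=
  fun n hn => growingTowersTerminate_of_hugging (cornerNormalForm_of_plus (hN n hn)) (h n hn)

/-- … in particular `NoHuggingTowers → NoGrowingTowers` modulo (M1⁺). [folklore] -/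
theorem noGrowingTowers_of_noHugging (hN : MaxContactCut.CornerNormalFormAll) (h : MaxContactCut.NoHuggingTowers) :
    MaxContactCut.NoGrowingTowers :=
  noGrowingTowers_of_hugging hN fun n hn => noTower_mono (fun _ h' => h'.1) (h n hn)

end Summit.ResolutionOfSingularities.ResolutionOfSingularities.Theorems.MaxContactCutMonomialTowers
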